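import Summits.AtomisticToContinuum.BoseEinsteinCondensation.Theorems.BECSwapNoCatastropheAbsTorusDefs
import Literature.MathematicalPhysics.QuantumManyBody.BoseGasCutoffProduct
import Literature.MathematicalPhysics.QuantumManyBody.PeriodicMaxFormSimplicity
import HarnessLib

/-!
# Pair-profile hard layers: basic bookkeeping (helper file of crux `TorusHalfSwapOverlap`, stub H)

Route `BECSwapNoCatastrophe`, crux `TorusHalfSwapOverlap` (stmt-AtomisticToContinuum-14393), line `registered` v7
(truncation split), stub H `stub_absMaxFormBoundPair` (the maximal-form bound on the absolute class for an
interaction with a PROFILE PER PAIR, hard cores allowed pair by pair). This file is the pair-profile twin of the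
`v`-dependent lemmas of `Literature/…/BoseGasHardLayer.lean`, `BoseGasHardLayerLines.lean` and of the potential-energy
half of `BoseGasCutoffProduct.lean` (`hardRad v ↦ hardRad (V i j)`, `periodicInteraction v L ↦ pairInteraction V L`,
`awayProfile v θ ↦ softProfile (V i j) θ`), plus the integrability of the softened pair-profile interaction on the cell.
Everything `v`-independent (pair-image radii along lines and under lattice translations) is imported, not duplicated.
-/

noncomputable section

namespace Summit.AtomisticToContinuum.BoseEinsteinCondensation.AbsTorus

open MeasureTheory Filter Set Metric
open scoped ENNReal NNReal BigOperators
open Literature.MathematicalPhysics.QuantumManyBody.BoseGas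

variable {N : ℕ} {V : Fin N → Fin N → ℝ → ℝ≥0∞} {L : ℝ}

/-! ### Monotonicity in the width -/

/-- The pair-profile hard layers increase with the width. [folklore] -/
theorem hardLayerP_mono (V : Fin N → Fin N → ℝ → ℝ≥0∞) (L : ℝ) {s s' : ℝ} (h : s ≤ s') :
    hardLayerP V L s ⊆ hardLayerP V L s' := by
  rintro X ⟨i, j, n, hij, hne, hX⟩
  exact ⟨i, j, n, hij, hne, hX.trans h⟩

/-- The pair-profile transition zones increase with the width. [folklore] -/
theorem hardZoneP_mono (V : Fin N → Fin N → ℝ → ℝ≥0∞) (L : ℝ) {s s' : ℝ} (h : s ≤ s') :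
    hardZoneP V L s ⊆ hardZoneP V L s' := by
  rintro X ⟨i, j, n, hij, hne, h0, hX⟩
  exact ⟨i, j, n, hij, hne, h0, hX.trans (by linarith)⟩

/-- The transition zone lies in the hard layer of triple width. [folklore] -/
theorem hardZoneP_subset_hardLayerP (V : Fin N → Fin N → ℝ → ℝ≥0∞) (L s : ℝ) :
    hardZoneP V L s ⊆ hardLayerP V L (3 * s) := by
  rintro X ⟨i, j, n, hij, hne, -, hX⟩
  exact ⟨i, j, n, hij, hne, hX⟩

/-! ### Lattice periodicity -/

/-- The pair-profile hard layers are lattice periodic. [folklore] -/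
theorem add_latticeVecN_mem_hardLayerP_iff (X : Config N) (m : Fin N → Fin 3 → ℤ) (s : ℝ) :
    X + latticeVecN L m ∈ hardLayerP V L s ↔ X ∈ hardLayerP V L s := by
  constructor
  · rintro ⟨i, j, n, hij, hne, h⟩
    exact ⟨i, j, n - m i + m j, hij, hne, by rwa [pairRad_add_latticeVecN] at h⟩
  · rintro ⟨i, j, n, hij, hne, h⟩
    refine ⟨i, j, n + m i - m j, hij, hne, ?_⟩
    rwa [pairRad_add_latticeVecN, show n + m i - m j - m i + m j = n by abel]

/-- The pair-profile transition zones are lattice periodic. [folklore] -/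
theorem add_latticeVecN_mem_hardZoneP_iff (X : Config N) (m : Fin N → Fin 3 → ℤ) (s : ℝ) :
    X + latticeVecN L m ∈ hardZoneP V L s ↔ X ∈ hardZoneP V L s := by
  constructor
  · rintro ⟨i, j, n, hij, hne, h0, h⟩
    exact ⟨i, j, n - m i + m j, hij, hne, by rwa [pairRad_add_latticeVecN] at h0,
      by rwa [pairRad_add_latticeVecN] at h⟩
  · rintro ⟨i, j, n, hij, hne, h0, h⟩
    refine ⟨i, j, n + m i - m j, hij, hne, ?_, ?_⟩
    · rwa [pairRad_add_latticeVecN, show n + m i - m j - m i + m j = n by abel]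
    · rwa [pairRad_add_latticeVecN, show n + m i - m j - m i + m j = n by abel]

/-- The pair-profile hard layers are torus periodic (as `Prop`-valued functions). [folklore] -/
theorem isTorusPeriodic_mem_hardLayerP (V : Fin N → Fin N → ℝ → ℝ≥0∞) (L s : ℝ) :
    IsTorusPeriodic L (fun X : Config N => X ∈ hardLayerP V L s) := by
  intro X i k
  rw [single_single_eq_latticeVecN]
  exact propext (add_latticeVecN_mem_hardLayerP_iff X _ s)

/-- The pair-profile transition zones are torus periodic (as `Prop`-valued functions). [folklore] -/
theorem isTorusPeriodic_mem_hardZoneP (V : Fin N → Fin N → ℝ → ℝ≥0∞) (L s : ℝ) :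
    IsTorusPeriodic L (fun X : Config N => X ∈ hardZoneP V L s) := by
  intro X i k
  rw [single_single_eq_latticeVecN]
  exact propext (add_latticeVecN_mem_hardZoneP_iff X _ s)

/-- The pair-profile interaction is torus periodic. [folklore] -/
theorem isTorusPeriodic_pairInteraction (V : Fin N → Fin N → ℝ → ℝ≥0∞) (L : ℝ) :
    IsTorusPeriodic L (pairInteraction V L) := by
  intro X i k
  rw [single_single_eq_latticeVecN]
  set m : Fin N → Fin 3 → ℤ := Pi.single i (Pi.single k 1)
  unfold pairInteraction periodizedPotential
  refine Finset.sum_congr rfl fun a _ => Finset.sum_congr rfl fun b _ => ?_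
  have h := fun n => pairRad_add_latticeVecN L X m a b n
  simp only [pairRad] at h
  simp only [h]
  exact (Equiv.tsum_eq (((Equiv.subRight (m a)).trans (Equiv.addRight (m b))))
    fun n => V a b ‖X a - X b - latticeVec L n‖)

/-! ### Measurability -/

/-- The pair-profile hard layers are measurable. [folklore] -/
theorem measurableSet_hardLayerP (V : Fin N → Fin N → ℝ → ℝ≥0∞) (L s : ℝ) : MeasurableSet (hardLayerP V L s) := by
  have h : hardLayerP V L s = ⋃ i : Fin N, ⋃ j : Fin N, ⋃ n : Fin 3 → ℤ,
      {X | i ≠ j ∧ (hardRad (V i j)).Nonempty ∧ infDist (pairRad L X i j n) (hardRad (V i j)) ≤ s} := by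
    ext X; simp only [hardLayerP, mem_setOf_eq, mem_iUnion]
  rw [h]
  refine MeasurableSet.iUnion fun i => MeasurableSet.iUnion fun j => MeasurableSet.iUnion fun n => ?_
  by_cases hij : i = j
  · simp [hij]
  · by_cases hne : (hardRad (V i j)).Nonempty
    · simp only [hij, not_false_eq_true, hne, true_and, ne_eq]
      exact measurableSet_le ((continuous_infDist_pt _).measurable.comp (continuous_pairRad L i j n).measurable)
        measurable_const
    · simp [hne]

/-- The pair-profile transition zones are measurable. [folklore] -/
theorem measurableSet_hardZoneP (V : Fin N → Fin N → ℝ → ℝ≥0∞) (L s : ℝ) : MeasurableSet (hardZoneP V L s) := by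
  have h : hardZoneP V L s = ⋃ i : Fin N, ⋃ j : Fin N, ⋃ n : Fin 3 → ℤ,
      {X | i ≠ j ∧ (hardRad (V i j)).Nonempty ∧ 0 < infDist (pairRad L X i j n) (hardRad (V i j)) ∧
        infDist (pairRad L X i j n) (hardRad (V i j)) ≤ 3 * s} := by
    ext X; simp only [hardZoneP, mem_setOf_eq, mem_iUnion]
  rw [h]
  refine MeasurableSet.iUnion fun i => MeasurableSet.iUnion fun j => MeasurableSet.iUnion fun n => ?_
  by_cases hij : i = j
  · simp [hij]
  · by_cases hne : (hardRad (V i j)).Nonempty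
    · simp only [hij, not_false_eq_true, hne, true_and, ne_eq]
      have hm : Measurable fun X : Config N => infDist (pairRad L X i j n) (hardRad (V i j)) :=
        (continuous_infDist_pt _).measurable.comp (continuous_pairRad L i j n).measurable
      exact (measurableSet_lt measurable_const hm).inter (measurableSet_le hm measurable_const)
    · simp [hne]

/-- The pair-profile interaction of measurable profiles is measurable. [folklore] -/
theorem measurable_pairInteraction (hV : ∀ i j, Measurable (V i j)) (L : ℝ) :
    Measurable (pairInteraction V L) := by
  unfold pairInteraction periodizedPotential
  refine Finset.measurable_sum _ fun i _ => Finset.measurable_sum _ fun j _ => ?_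
  exact (Measurable.tsum fun n => (hV i j).comp (measurable_id.sub_const _).norm).comp
    ((measurable_config_apply i).sub (measurable_config_apply j))

/-! ### Domination and monotonicity -/

/-- One image-pair term is dominated by the pair-profile interaction (symmetric profile matrix): for `i ≠ j` and
every lattice image `n`, `(V i j)(pairRad L X i j n) ≤ W_V(X)`. [folklore] -/
theorem apply_pairRad_le_pairInteraction (hVs : ∀ i j, V i j = V j i) (L : ℝ) (X : Config N) {i j : Fin N}
    (hij : i ≠ j) (n : Fin 3 → ℤ) : V i j (pairRad L X i j n) ≤ pairInteraction V L X := by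
  have key : ∀ {i j : Fin N}, i < j → ∀ n : Fin 3 → ℤ,
      V i j ‖X i - X j - latticeVec L n‖ ≤ pairInteraction V L X := by
    intro i j h n
    unfold pairInteraction
    calc V i j ‖X i - X j - latticeVec L n‖ ≤ periodizedPotential (V i j) L (X i - X j) := by
          unfold periodizedPotential; exact ENNReal.le_tsum n
      _ ≤ ∑ j' : Fin N with i < j', periodizedPotential (V i j') L (X i - X j') :=
          Finset.single_le_sum (f := fun j' => periodizedPotential (V i j') L (X i - X j'))
            (fun _ _ => zero_le) (Finset.mem_filter.2 ⟨Finset.mem_univ _, h⟩)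
      _ ≤ ∑ i' : Fin N, ∑ j' : Fin N with i' < j', periodizedPotential (V i' j') L (X i' - X j') :=
          Finset.single_le_sum (f := fun i' => ∑ j' : Fin N with i' < j', periodizedPotential (V i' j') L (X i' - X j'))
            (fun _ _ => zero_le) (Finset.mem_univ _)
  unfold pairRad
  rcases lt_or_gt_of_ne hij with h | h
  · exact key h n
  · rw [hVs i j, show ‖X i - X j - latticeVec L n‖ = ‖X j - X i - latticeVec L (-n)‖ by
      rw [← norm_neg]; congr 1; ext k; simp [latticeVec_apply]; ring]
    exact key h (-n)

/-- The pair-profile interaction is monotone in the profile matrix. [folklore] -/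
theorem pairInteraction_mono_profile {V W : Fin N → Fin N → ℝ → ℝ≥0∞} (h : ∀ i j r, W i j r ≤ V i j r) (L : ℝ)
    (X : Config N) : pairInteraction W L X ≤ pairInteraction V L X := by
  unfold pairInteraction periodizedPotential
  exact Finset.sum_le_sum fun i _ => Finset.sum_le_sum fun j _ => ENNReal.tsum_le_tsum fun n => h i j _

/-- The pair-profile interaction is dominated by the one-profile interaction of the sum of the profiles. [folklore] -/
theorem pairInteraction_le_periodicInteraction_sum (V : Fin N → Fin N → ℝ → ℝ≥0∞) (L : ℝ) (X : Config N) :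
    pairInteraction V L X ≤ periodicInteraction (fun r => ∑ i : Fin N, ∑ j : Fin N, V i j r) L X := by
  unfold pairInteraction periodicInteraction periodizedPotential
  refine Finset.sum_le_sum fun i _ => Finset.sum_le_sum fun j _ => ENNReal.tsum_le_tsum fun n => ?_
  exact (Finset.single_le_sum (f := fun j' => V i j' ‖X i - X j - latticeVec L n‖) (fun _ _ => zero_le)
    (Finset.mem_univ j)).trans
    (Finset.single_le_sum (f := fun i' => ∑ j' : Fin N, V i' j' ‖X i - X j - latticeVec L n‖) (fun _ _ => zero_le)
      (Finset.mem_univ i))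

/-! ### Softened profiles -/

/-- The softened profile is dominated by the profile. [folklore] -/
theorem softProfile_le (w : ℝ → ℝ≥0∞) (θ r : ℝ) : softProfile w θ r ≤ w r := by
  by_cases h : (hardRad w).Nonempty
  · rw [softProfile_of_nonempty h]; exact awayProfile_le w θ r
  · rw [softProfile_of_not_nonempty h]

/-- The softened profile of a measurable profile is measurable. [folklore] -/
theorem measurable_softProfile {w : ℝ → ℝ≥0∞} (hw : Measurable w) (θ : ℝ) : Measurable (softProfile w θ) := by
  by_cases h : (hardRad w).Nonempty
  · rw [softProfile_of_nonempty h]; exact measurable_awayProfile hw θ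
  · rwa [softProfile_of_not_nonempty h]

/-- The softened profile inherits the range of the profile. [folklore] -/
theorem softProfile_eq_zero_of_range {w : ℝ → ℝ≥0∞} {R₀ : ℝ} (hw0 : ∀ r, R₀ < r → w r = 0) (θ : ℝ) {r : ℝ}
    (hr : R₀ < r) : softProfile w θ r = 0 :=
  nonpos_iff_eq_zero.1 ((softProfile_le w θ r).trans (hw0 r hr).le)

/-- The softened profile of a repulsive finite-range profile is repulsive finite-range. [folklore] -/
theorem isRepulsiveFiniteRange_softProfile {w : ℝ → ℝ≥0∞} (hw : IsRepulsiveFiniteRange w) (θ : ℝ) :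
    IsRepulsiveFiniteRange (softProfile w θ) := by
  obtain ⟨R₀, hR₀⟩ := hw.2
  exact ⟨measurable_softProfile hw.1 θ, R₀, fun r hr => softProfile_eq_zero_of_range hR₀ θ hr⟩

/-- Away from the `θ`-neighbourhood of its hard radii (vacuous if there are none) the softened profile is the
profile. [folklore] -/
theorem softProfile_eq_of_le {w : ℝ → ℝ≥0∞} {θ r : ℝ} (h : (hardRad w).Nonempty → θ ≤ infDist r (hardRad w)) :
    softProfile w θ r = w r := by
  by_cases hne : (hardRad w).Nonempty
  · rw [softProfile_of_nonempty hne]; exact awayProfile_eq_of_le (h hne)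
  · rw [softProfile_of_not_nonempty hne]

/-- **The softened profile of a finite-range potential is integrable on `ℝ³`** (`θ > 0`): with hard radii it is
`awayProfile` (`lintegral_awayProfile_norm_ne_top`), without it is the profile itself
(`lintegral_norm_ne_top_of_hardRad_eq_empty`). [folklore] -/
theorem lintegral_softProfile_norm_ne_top {w : ℝ → ℝ≥0∞} {R₀ : ℝ} (hw0 : ∀ r, R₀ < r → w r = 0) {θ : ℝ}
    (hθ : 0 < θ) : ∫⁻ z : Space, softProfile w θ ‖z‖ ≠ ⊤ := by
  by_cases hne : (hardRad w).Nonempty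
  · simp only [softProfile_of_nonempty hne]
    exact lintegral_awayProfile_norm_ne_top hw0 hθ
  · simp only [softProfile_of_not_nonempty hne]
    exact lintegral_norm_ne_top_of_hardRad_eq_empty hw0 (not_nonempty_iff_eq_empty.1 hne)

/-- Off the pair-profile hard layer of width `θ` the softened profiles see the same interaction as the profiles.
[folklore] -/
theorem pairInteraction_eq_softProfile_of_notMem {θ : ℝ} {X : Config N} (hX : X ∉ hardLayerP V L θ) :
    pairInteraction V L X = pairInteraction (fun i j => softProfile (V i j) θ) L X := by
  unfold pairInteraction periodizedPotential
  refine Finset.sum_congr rfl fun i _ => Finset.sum_congr rfl fun j hj => tsum_congr fun n => ?_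
  have hij : i ≠ j := (Finset.mem_filter.1 hj).2.ne
  have h : (hardRad (V i j)).Nonempty → ¬ infDist (pairRad L X i j n) (hardRad (V i j)) ≤ θ :=
    fun hne hle => hX ⟨i, j, n, hij, hne, hle⟩
  rw [← pairRad]
  exact (softProfile_eq_of_le fun hne => (not_le.1 (h hne)).le).symm

/-- **Potential energy of the cut-off product**: if `ξ ∈ [0,1]` vanishes on `hardLayerP V L θ` then
`W_V |ξΨ|² ≤ W_{soft V θ} |Ψ|²` pointwise. [folklore] -/
theorem pot_ofReal_mul_le_softProfile {ξ : Config N → ℝ} (h01 : ∀ X, 0 ≤ ξ X ∧ ξ X ≤ 1) {θ : ℝ}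
    (h0 : ∀ X ∈ hardLayerP V L θ, ξ X = 0) (Ψ : Config N → ℂ) (X : Config N) :
    pairInteraction V L X * ((‖(ξ X : ℂ) * Ψ X‖₊ : ℝ≥0∞)) ^ 2 ≤
      pairInteraction (fun i j => softProfile (V i j) θ) L X * (‖Ψ X‖₊ : ℝ≥0∞) ^ 2 := by
  by_cases hX : X ∈ hardLayerP V L θ
  · rw [h0 X hX]; simp
  · rw [pairInteraction_eq_softProfile_of_notMem hX]
    exact mul_le_mul_right (nnnorm_ofReal_mul_sq_le h01 Ψ X) _

/-! ### Integrability of the (softened) pair-profile interaction on the cell -/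

/-- **The pair-profile interaction of integrable profiles is integrable on the cell**: if every profile is
measurable with `∫_{ℝ³} (V i j)(|x|) dx < ∞` then `∫_{[0,L)^{3N}} W_V < ∞` (domination by the one-profile interaction
of the sum of the profiles and `lintegral_cellN_periodicInteraction_ne_top_of_lintegral_ne_top`). [folklore] -/
theorem lintegral_cellN_pairInteraction_ne_top (hL : 0 < L) (hV : ∀ i j, Measurable (V i j))
    (hint : ∀ i j, (∫⁻ x : Space, V i j ‖x‖) ≠ ⊤) : ∫⁻ X in cellN N L, pairInteraction V L X ≠ ⊤ := by
  set u : ℝ → ℝ≥0∞ := fun r => ∑ i : Fin N, ∑ j : Fin N, V i j r with hu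
  have hum : Measurable u := Finset.measurable_sum _ fun i _ => Finset.measurable_sum _ fun j _ => hV i j
  have huint : (∫⁻ x : Space, u ‖x‖) ≠ ⊤ := by
    have h1 : (∫⁻ x : Space, u ‖x‖) = ∑ i : Fin N, ∑ j : Fin N, ∫⁻ x : Space, V i j ‖x‖ := by
      simp only [hu]
      rw [lintegral_finsetSum (s := Finset.univ) (f := fun i (x : Space) => ∑ j : Fin N, V i j ‖x‖)
        fun i _ => Finset.measurable_sum _ fun j _ => (hV i j).comp measurable_norm]
      exact Finset.sum_congr rfl fun i _ => lintegral_finsetSum (s := Finset.univ) (f := fun j (x : Space) => V i j ‖x‖)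
        fun j _ => (hV i j).comp measurable_norm
    rw [h1]
    exact ENNReal.sum_ne_top.2 fun i _ => ENNReal.sum_ne_top.2 fun j _ => hint i j
  exact ne_top_of_le_ne_top (lintegral_cellN_periodicInteraction_ne_top_of_lintegral_ne_top hL hum huint N)
    (lintegral_mono fun X => pairInteraction_le_periodicInteraction_sum V L X)

/-- **The softened pair-profile interaction of finite-range profiles is integrable on the cell** (`θ > 0`). [folklore] -/
theorem lintegral_cellN_pairInteraction_softProfile_ne_top (hL : 0 < L) (hV : ∀ i j, IsRepulsiveFiniteRange (V i j))
    {θ : ℝ} (hθ : 0 < θ) :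
    ∫⁻ X in cellN N L, pairInteraction (fun i j => softProfile (V i j) θ) L X ≠ ⊤ := by
  refine lintegral_cellN_pairInteraction_ne_top hL (fun i j => measurable_softProfile (hV i j).1 θ) fun i j => ?_
  obtain ⟨R₀, hR₀⟩ := (hV i j).2
  exact lintegral_softProfile_norm_ne_top hR₀ hθ

end Summit.AtomisticToContinuum.BoseEinsteinCondensation.AbsTorus

end
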